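import Summits.Langlands.Langlands.Theorems.IrreducibilityBySelfDualityReciprocityUpToIrreducibilityRStringDefs
import HarnessLib

/-!
# `Hom` out of the standard string is the head space (toward stub S-17a-B of line `Sketch`,
# crux stmt-Langlands-17925 `IrreducibilityBySelfDuality.ReciprocityUpToIrreducibilityR`)

For the standard string `ρ ⊗ Sp(d) = stringModel ρ hρ d` on `Fin d → H` (slot `j` carries
`ρ ⊗ ‖·‖^j`, `N` = shift) and any Weil–Deligne representation `σ` with an `N`-stable subspace `U`,
restriction to slot `0` is a linear isomorphism
`Hom_WD(ρ ⊗ Sp(d), σ; U) = homWDIn (stringModel ρ hρ d) σ U ⥲ headSpace ρ σ d U = Hom_W(ρ, σ; N^d = 0, U)`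
with inverse `g ↦ ((y_j) ↦ Σ_j N^j g(y_j))` (Henniart 2002, §4: a morphism out of a string is determined by
its head; registered sub-goal `stub_finrank_homWDIn_stringModel_eq_headSpace`).  One definition: the head
space `headSpace ρ σ d U` (`W_F`-equivariant `g : H → V` with `N^d ∘ g = 0` and values in `U`).
-/

noncomputable section

set_option linter.dupNamespace false

open Module
open Literature.NumberTheory.Automorphic Literature.NumberTheory.GaloisRepresentations
open Literature.NumberTheory.GaloisRepresentations.WeilGroup
open Literature.NumberTheory.GaloisRepresentations.IsNonarchimedeanLocalField

namespace Summit.Langlands.Langlands.Theorems.ReciprocityUpToIrreducibilityR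

variable {F : Type} [Field F] [ValuativeRel F] [TopologicalSpace F] [IsNonarchimedeanLocalField F]
variable {V : Type*} [AddCommGroup V] [Module ℂ V] {H : Type*} [AddCommGroup H] [Module ℂ H]

/-- **The head space `Hom_W(ρ, σ; N^d = 0, U)`**: `W_F`-equivariant linear maps `g : (H, ρ) → (V, σ)`
killed by `N^d` (`N^d ∘ g = 0`) with values in the subspace `U`.  For the standard string
`ρ ⊗ Sp(d) = stringModel ρ hρ d`, restriction to slot `0` identifies `Hom_WD(ρ ⊗ Sp(d), σ; U)` with this
space (Henniart 2002, §4: a morphism out of a string is determined by its head).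
[cite: HenniartBSMF2002, §4] -/
def headSpace (ρ : Representation ℂ (WeilGroup F) H) (σ : WeilDeligneRep F ℂ V) (d : ℕ)
    (U : Submodule ℂ V) : Submodule ℂ (H →ₗ[ℂ] V) where
  carrier := {g | (∀ w : WeilGroup F, g ∘ₗ ρ w = σ.ρ w ∘ₗ g) ∧ (σ.N ^ d) ∘ₗ g = 0 ∧ ∀ x, g x ∈ U}
  add_mem' := by
    rintro f g ⟨hf, hfN, hfU⟩ ⟨hg, hgN, hgU⟩
    exact ⟨fun w => by rw [LinearMap.add_comp, LinearMap.comp_add, hf, hg],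
      by rw [LinearMap.comp_add, hfN, hgN, add_zero], fun x => Submodule.add_mem _ (hfU x) (hgU x)⟩
  zero_mem' := ⟨fun w => by rw [LinearMap.zero_comp, LinearMap.comp_zero],
    by rw [LinearMap.comp_zero], fun x => Submodule.zero_mem _⟩
  smul_mem' := by
    rintro c f ⟨hf, hfN, hfU⟩
    exact ⟨fun w => by rw [LinearMap.smul_comp, LinearMap.comp_smul, hf],
      by rw [LinearMap.comp_smul, hfN, smul_zero], fun x => Submodule.smul_mem _ c (hfU x)⟩

/-- Membership in the head space (definitional). [cite: HenniartBSMF2002, §4] -/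
theorem mem_headSpace_iff {ρ : Representation ℂ (WeilGroup F) H} {σ : WeilDeligneRep F ℂ V} {d : ℕ}
    {U : Submodule ℂ V} {g : H →ₗ[ℂ] V} : g ∈ headSpace ρ σ d U ↔
      (∀ w : WeilGroup F, g ∘ₗ ρ w = σ.ρ w ∘ₗ g) ∧ (σ.N ^ d) ∘ₗ g = 0 ∧ ∀ x, g x ∈ U := Iff.rfl

section Model

variable (ρ : Representation ℂ (WeilGroup F) H) (hρ : WeilGroup.IsContinuousRep ρ) (σ : WeilDeligneRep F ℂ V)

/-- The standard string acts on a vector concentrated in slot `0` through `ρ`. [cite: TateCorvallis1979, (4.1.4)] -/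
theorem stringModelRep_single_zero (d : ℕ) (w : WeilGroup F) (x : H) :
    stringModelRep ρ (d + 1) w (Pi.single 0 x) = Pi.single 0 (ρ w x) := by
  funext j
  rw [stringModelRep_apply]
  by_cases hj : j = 0
  · subst hj; simp
  · simp [hj]

/-- Powers of the shift move slot `0` to slot `j`. [folklore] -/
theorem shiftMap_pow_single_zero (d : ℕ) (j : Fin (d + 1)) (x : H) :
    (shiftMap H (d + 1) ^ (j : ℕ)) (Pi.single 0 x) = Pi.single j x := by
  funext i
  rw [shiftMap_pow_apply]
  by_cases hij : i = j
  · subst hij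
    simp
  · rw [Pi.single_eq_of_ne hij]
    split_ifs with hle
    · have : (⟨(i : ℕ) - j, by omega⟩ : Fin (d + 1)) ≠ 0 := by
        intro h0
        apply hij
        apply Fin.ext
        have := congrArg Fin.val h0
        simp only [Fin.val_zero] at this
        omega
      exact Pi.single_eq_of_ne this _
    · rfl

/-- A morphism `f : ρ ⊗ Sp(d) → σ` satisfies `f ∘ N^k = N^k ∘ f`. [folklore] -/
theorem comp_pow_shiftMap_of_mem_homWD {d : ℕ} {f : (Fin d → H) →ₗ[ℂ] V}
    (hf : f ∈ homWD (stringModel ρ hρ d) σ) (k : ℕ) : f ∘ₗ (shiftMap H d ^ k) = (σ.N ^ k) ∘ₗ f := by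
  induction k with
  | zero => simp [Module.End.one_eq_id]
  | succ k ih =>
    rw [pow_succ, Module.End.mul_eq_comp, ← LinearMap.comp_assoc, ih, LinearMap.comp_assoc,
      ← stringModel_N ρ hρ d, hf.2, ← LinearMap.comp_assoc, ← Module.End.mul_eq_comp, ← pow_succ]

/-- **Restriction to the head**: `f ↦ f ∘ ι₀` maps `Hom_WD(ρ ⊗ Sp(d+1), σ; U)` into the head space.
[cite: HenniartBSMF2002, §4] -/
theorem res_mem_headSpace {d : ℕ} {U : Submodule ℂ V} {f : (Fin (d + 1) → H) →ₗ[ℂ] V}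
    (hf : f ∈ homWDIn (stringModel ρ hρ (d + 1)) σ U) :
    f ∘ₗ LinearMap.single ℂ (fun _ : Fin (d + 1) => H) 0 ∈ headSpace ρ σ (d + 1) U := by
  refine ⟨fun w => ?_, ?_, fun x => hf.2 _⟩
  · refine LinearMap.ext fun x => ?_
    have h1 := congr($(hf.1.1 w) (Pi.single 0 x))
    simp only [LinearMap.coe_comp, Function.comp_apply, stringModel_ρ, stringModelRep_single_zero] at h1
    simpa using h1
  · rw [← LinearMap.comp_assoc, ← comp_pow_shiftMap_of_mem_homWD ρ hρ σ hf.1, shiftMap_pow_eq_zero,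
      LinearMap.comp_zero, LinearMap.zero_comp]

/-- **Extension from the head**: `g ↦ ((y_j) ↦ Σ_j N^j g(y_j))` maps the head space into
`Hom_WD(ρ ⊗ Sp(d), σ; U)` for `N`-stable `U`. [cite: HenniartBSMF2002, §4] -/
theorem ext_mem_homWDIn {d : ℕ} {U : Submodule ℂ V} (hU : U ≤ U.comap σ.N) {g : H →ₗ[ℂ] V}
    (hg : g ∈ headSpace ρ σ d U) :
    strMap σ d ∘ₗ LinearMap.pi (fun j : Fin d => g ∘ₗ LinearMap.proj j) ∈
      homWDIn (stringModel ρ hρ d) σ U := by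
  have hpi : ∀ y : Fin d → H, LinearMap.pi (fun j : Fin d => g ∘ₗ LinearMap.proj j) y = fun j => g (y j) :=
    fun y => rfl
  refine ⟨⟨fun w => ?_, ?_⟩, fun y => ?_⟩
  · refine LinearMap.ext fun y => ?_
    simp only [LinearMap.coe_comp, Function.comp_apply, hpi, stringModel_ρ, ρ_strMap]
    congr 1
    funext j
    rw [stringModelRep_apply, map_smul, show g (ρ w (y j)) = σ.ρ w (g (y j)) from congr($(hg.1 w) (y j))]
  · refine LinearMap.ext fun y => ?_
    simp only [LinearMap.coe_comp, Function.comp_apply, hpi, stringModel_N]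
    cases d with
    | zero => simp [strMap_apply]
    | succ d =>
      have hlast : (σ.N ^ (d + 1)) (g (y (Fin.last d))) = 0 := congr($(hg.2.1) (y (Fin.last d)))
      rw [N_strMap_succ σ d _ hlast]
      congr 1
      funext j
      rw [shiftMap_apply]
      refine Fin.cases ?_ (fun i => ?_) j
      · simp
      · simp only [Fin.cons_succ, Fin.val_succ, Nat.add_one_ne_zero, ↓reduceDIte, Nat.add_sub_cancel]
        rfl
  · simp only [LinearMap.coe_comp, Function.comp_apply, hpi, strMap_apply]
    refine Submodule.sum_mem _ fun j _ => ?_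
    have : ∀ (k : ℕ) (v : V), v ∈ U → (σ.N ^ k) v ∈ U := by
      intro k
      induction k with
      | zero => intro v hv; simpa using hv
      | succ k ih => intro v hv; rw [pow_succ', Module.End.mul_apply]; exact hU (ih v hv)
    exact this _ _ (hg.2.2 (y j))

/-- `res ∘ ext = id`. [folklore] -/
theorem res_ext {d : ℕ} (g : H →ₗ[ℂ] V) :
    (strMap σ (d + 1) ∘ₗ LinearMap.pi (fun j : Fin (d + 1) => g ∘ₗ LinearMap.proj j)) ∘ₗ
      LinearMap.single ℂ (fun _ : Fin (d + 1) => H) 0 = g := by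
  refine LinearMap.ext fun x => ?_
  simp only [LinearMap.coe_comp, Function.comp_apply, LinearMap.coe_single, strMap_apply, LinearMap.pi_apply,
    LinearMap.coe_proj, Function.eval]
  rw [Finset.sum_eq_single (0 : Fin (d + 1)) (fun j _ hj => by simp [hj]) (by simp)]
  simp

/-- `ext ∘ res = id` on `Hom_WD(ρ ⊗ Sp(d+1), σ)`. [folklore] -/
theorem ext_res {d : ℕ} {f : (Fin (d + 1) → H) →ₗ[ℂ] V} (hf : f ∈ homWD (stringModel ρ hρ (d + 1)) σ) :
    strMap σ (d + 1) ∘ₗ LinearMap.pi (fun j : Fin (d + 1) =>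
      (f ∘ₗ LinearMap.single ℂ (fun _ : Fin (d + 1) => H) 0) ∘ₗ LinearMap.proj j) = f := by
  refine LinearMap.ext fun y => ?_
  simp only [LinearMap.coe_comp, Function.comp_apply, strMap_apply, LinearMap.pi_apply, LinearMap.coe_proj,
    Function.eval, LinearMap.coe_single]
  conv_rhs => rw [← Finset.univ_sum_single y, map_sum]
  refine Finset.sum_congr rfl fun j _ => ?_
  rw [← shiftMap_pow_single_zero d j (y j), ← LinearMap.comp_apply (f := σ.N ^ (j : ℕ)),
    ← comp_pow_shiftMap_of_mem_homWD ρ hρ σ hf, LinearMap.comp_apply]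

/-- **`Hom_WD(ρ ⊗ Sp(d), σ; U) ≅ headSpace ρ σ d U`** for `N`-stable `U`: equal dimensions.
[cite: HenniartBSMF2002, §4] -/
theorem finrank_homWDIn_stringModel (d : ℕ) {U : Submodule ℂ V} (hU : U ≤ U.comap σ.N) :
    finrank ℂ (homWDIn (stringModel ρ hρ d) σ U) = finrank ℂ (headSpace ρ σ d U) := by
  cases d with
  | zero =>
    -- both spaces are zero
    have h1 : homWDIn (stringModel ρ hρ 0) σ U = ⊥ := by
      rw [eq_bot_iff]; intro f _; rw [Submodule.mem_bot]
      exact LinearMap.ext fun y => by rw [Subsingleton.elim y 0, map_zero, LinearMap.zero_apply]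
    have h2 : headSpace ρ σ 0 U = ⊥ := by
      rw [eq_bot_iff]; intro g hg; rw [Submodule.mem_bot]
      have := hg.2.1
      rwa [pow_zero, Module.End.one_eq_id, LinearMap.id_comp] at this
    rw [h1, h2, finrank_bot, finrank_bot]
  | succ d =>
    set X := homWDIn (stringModel ρ hρ (d + 1)) σ U
    set Y := headSpace ρ σ (d + 1) U
    let res : X →ₗ[ℂ] Y :=
      { toFun := fun f => ⟨f.1 ∘ₗ LinearMap.single ℂ (fun _ : Fin (d + 1) => H) 0, res_mem_headSpace ρ hρ σ f.2⟩
        map_add' := fun f f' => Subtype.ext (LinearMap.add_comp _ _ _)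
        map_smul' := fun c f => Subtype.ext (LinearMap.smul_comp _ _ _) }
    let ext : Y →ₗ[ℂ] X :=
      { toFun := fun g => ⟨strMap σ (d + 1) ∘ₗ LinearMap.pi (fun j : Fin (d + 1) => g.1 ∘ₗ LinearMap.proj j),
          ext_mem_homWDIn ρ hρ σ hU g.2⟩
        map_add' := fun g g' => Subtype.ext (LinearMap.ext fun y => by
          simp [strMap_apply, Finset.sum_add_distrib])
        map_smul' := fun c g => Subtype.ext (LinearMap.ext fun y => by
          simp [strMap_apply, Finset.smul_sum]) }
    have e : X ≃ₗ[ℂ] Y :=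
      { res with
        invFun := ext
        left_inv := fun f => Subtype.ext (ext_res ρ hρ σ f.2.1)
        right_inv := fun g => Subtype.ext (res_ext σ g.1) }
    exact e.finrank_eq

end Model

/-- **Registered sub-goal `stub_finrank_homWDIn_stringModel_eq_headSpace`**: a morphism out of the standard
string is determined by its head — `dim Hom_WD(ρ ⊗ Sp(d), σ; U) = dim Hom_W(ρ, σ; N^d = 0, U)` for
`N`-stable `U`. [cite: HenniartBSMF2002, §4] -/
theorem stub_finrank_homWDIn_stringModel_eq_headSpace : ∀ (F : Type) [Field F] [ValuativeRel F] [TopologicalSpace F] [IsNonarchimedeanLocalField F] (H : Type) [AddCommGroup H] [Module ℂ H] [FiniteDimensional ℂ H] (V : Type) [AddCommGroup V] [Module ℂ V] [FiniteDimensional ℂ V] (ρ : Representation ℂ (WeilGroup F) H) (hρ : WeilGroup.IsContinuousRep ρ) (d : ℕ) (σ : WeilDeligneRep F ℂ V) (U : Submodule ℂ V), U ≤ U.comap σ.N → Module.finrank ℂ ↥(homWDIn (stringModel ρ hρ d) σ U) = Module.finrank ℂ ↥(headSpace ρ σ d U) :=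
  fun _ _ _ _ _ _ _ _ _ _ _ _ _ ρ hρ d σ _ hU => finrank_homWDIn_stringModel ρ hρ σ d hU

end Summit.Langlands.Langlands.Theorems.ReciprocityUpToIrreducibilityR

end
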